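import Summits.AtomisticToContinuum.Crystallization.Theorems.OverbindingBudgetAffineCompressedCutHop

/-!
# OverbindingBudget · AffineCompressedCut — rider «Far» (lens-4 g82, head start on (iii) = the 79K energy inequality, part IV)

Cell `decomp-a2c`, seat lens-4, generation 82.  ELEMENTARY·PROVED, no new numeric hypothesis, no new `Prop` definitions.

THE FAR SCALE FLOORS under the leaf's own hypothesis `AffDeepReg 12 (1/10^4) (1/1000) (1/450) y i` (`y` injective, `0 < nn_i`), by HOPPING
(«Hop», part III) along the segment `[y i, y k]` through the points at `27/5, 8, 47/5, 101/10` (units `nn_i`):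

| tier | `dist (y k) (y i)` (units `nn_i`) | hops (`L`)                    | certified window for `nn_k` (units `nn_i`) | exact floor |
|------|------------------------------------|-------------------------------|--------------------------------------------|-------------|
| B    | `[27/5, 8]`                        | 31, 22                        | `[83/100, 107/100]`                        | 0.83930     |
| C    | `[8, 47/5]`                        | 31, 22, 15                    | `[79/100, 27/25]`                          | 0.79870     |
| D    | `[47/5, 101/10]`                   | 31, 22, 15, 10                | `[77/100, 109/100]`                        | 0.77273     |
| E    | `[101/10, 21/2]`                   | 31, 22, 15, 10, 8             | `[3/4, 11/10]`                             | 0.75256     |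

(`[0, 219/40]`: `[9/10, 26/25]` is «Core».)  Every hop is ONE application of `…Hop.hop` / `hop_site` with three closed `norm_num` side conditions
(budget `1 + e/lo < L·(9967/10⁴)^L/5`, containment `(hi + e) + d ≤ 12`, and the window literals).  Consumer: «Sum» (g83) — pairwise separation
`≥ σ·nn_i` on the tail annuli (`σ` = the floor of the outer tier, via `nearestDist_le_dist`), the input of `…Tail.sum_inv_pow_six_le_grid_scaled`.
* `far_scale_floor` — the one-line summary: `dist (y k) (y i) ≤ (21/2)·nn_i → (3/4)·nn_i ≤ nn_k`.
-/

namespace Summit.AtomisticToContinuum.Crystallization.Theorems.OverbindingBudgetAffineCompressedCutFar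

open Literature.Geometry.DiscreteGeometry (nearestDist nearestDist_nonneg nearestDist_le_dist fccTwoShellPattern hcpTwoShellPattern)
open Summit.AtomisticToContinuum.Crystallization.Theorems.OverbindingBudgetAffineLadder (AffFramed AffDeepReg)
open Summit.AtomisticToContinuum.Crystallization.Theorems.OverbindingBudgetAffineCompressedCutFrame (charts_of_affDeepReg)
open Summit.AtomisticToContinuum.Crystallization.Theorems.OverbindingBudgetAffineCompressedCutCore (core_scale_window)
open Summit.AtomisticToContinuum.Crystallization.Theorems.OverbindingBudgetAffineCompressedCutHop (hop hop_site segment_point dist_segment_points)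

variable {N : ℕ}

/-- **TIER B**: `dist (y k) (y i) ∈ [27/5, 8]·nn_i` ⟹ `nn_k ∈ [83/100, 107/100]·nn_i` (hops: `i → p(27/5) → y k`, `L = 31, 22`). [this file] -/
theorem tierB_window {y : Fin N → EuclideanSpace ℝ (Fin 3)} (hy : Function.Injective y) {i : Fin N} (hν : 0 < nearestDist y i)
    (hreg : AffDeepReg 12 (1 / 10 ^ 4) (1 / 1000) (1 / 450) y i) :
    ∀ k, 27 / 5 * nearestDist y i ≤ dist (y k) (y i) → dist (y k) (y i) ≤ 8 * nearestDist y i →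
      83 / 100 * nearestDist y i ≤ nearestDist y k ∧ nearestDist y k ≤ 107 / 100 * nearestDist y i := by
  obtain ⟨A, Q, P, f, hP, hA, hf, hinj, -, -, -⟩ := charts_of_affDeepReg hreg
  have hfr : ∀ j, dist (y j) (y i) ≤ 12 * nearestDist y i → AffFramed (1 / 10 ^ 4) (1 / 1000) (1 / 450) y j :=
    fun j hj => (hreg j hj).2
  intro k hlow hupp
  have hlow' : 27 / 5 * nearestDist y i ≤ dist (y i) (y k) := by rw [dist_comm]; exact hlow
  have hupp' : dist (y i) (y k) ≤ 8 * nearestDist y i := by rw [dist_comm]; exact hupp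
  have hd : 0 < dist (y i) (y k) := by linarith
  obtain ⟨p₁, hp₁⟩ : ∃ p, p = y i + ((27 / 5 * nearestDist y i) / dist (y i) (y k)) • (y k - y i) := ⟨_, rfl⟩
  obtain ⟨h1a, h1b⟩ := segment_point hd (by positivity) hlow' hp₁
  -- hop 1: `i → p₁`
  obtain ⟨j₁, hj₁, hlo₁, hhi₁, -⟩ := hop (R := 12) hy hν hP hA hf hinj hfr p₁ (lo := 1) (hi := 1) (e := 22 / 5) (L := 31) one_pos
    (by rw [one_mul]) (by rw [one_mul]) (by norm_num) (by rw [h1a]; linarith) (by rw [dist_comm, h1a]; linarith) (by norm_num)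
  -- hop 2: `j₁ → y k`
  have hbk : dist (y j₁) (y k) ≤ nearestDist y j₁ + 13 / 5 * nearestDist y i := by
    have := dist_triangle (y j₁) p₁ (y k)
    linarith [hj₁.le]
  have hc := mul_le_mul_of_nonneg_right (show ((10011 / 10000 : ℝ)) ^ 31 * 1 + 13 / 5 + 8 ≤ 12 by norm_num) hν.le
  obtain ⟨hlok, hhik⟩ := hop_site (R := 12) hy hν hP hA hf hinj hfr k (e := 13 / 5) (L := 22) (by positivity) hlo₁ hhi₁ (by norm_num) hbk
    (by linarith) (by norm_num)
  constructor
  · have e1 : (83 / 100 : ℝ) ≤ (9967 / 10000) ^ 22 * ((9967 / 10000) ^ 31 * 1) := by norm_num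
    exact le_trans (mul_le_mul_of_nonneg_right e1 hν.le) hlok
  · have e2 : ((10011 / 10000 : ℝ)) ^ 22 * ((10011 / 10000) ^ 31 * 1) ≤ 107 / 100 := by norm_num
    exact hhik.trans (mul_le_mul_of_nonneg_right e2 hν.le)

/-- **TIER C**: `dist (y k) (y i) ∈ [8, 47/5]·nn_i` ⟹ `nn_k ∈ [79/100, 27/25]·nn_i` (hops: `i → p(27/5) → p(8) → y k`, `L = 31, 22, 15`). [this file] -/
theorem tierC_window {y : Fin N → EuclideanSpace ℝ (Fin 3)} (hy : Function.Injective y) {i : Fin N} (hν : 0 < nearestDist y i)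
    (hreg : AffDeepReg 12 (1 / 10 ^ 4) (1 / 1000) (1 / 450) y i) :
    ∀ k, 8 * nearestDist y i ≤ dist (y k) (y i) → dist (y k) (y i) ≤ 47 / 5 * nearestDist y i →
      79 / 100 * nearestDist y i ≤ nearestDist y k ∧ nearestDist y k ≤ 27 / 25 * nearestDist y i := by
  obtain ⟨A, Q, P, f, hP, hA, hf, hinj, -, -, -⟩ := charts_of_affDeepReg hreg
  have hfr : ∀ j, dist (y j) (y i) ≤ 12 * nearestDist y i → AffFramed (1 / 10 ^ 4) (1 / 1000) (1 / 450) y j :=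
    fun j hj => (hreg j hj).2
  intro k hlow hupp
  have hlow' : 8 * nearestDist y i ≤ dist (y i) (y k) := by rw [dist_comm]; exact hlow
  have hupp' : dist (y i) (y k) ≤ 47 / 5 * nearestDist y i := by rw [dist_comm]; exact hupp
  have hd : 0 < dist (y i) (y k) := by linarith
  obtain ⟨p₁, hp₁⟩ : ∃ p, p = y i + ((27 / 5 * nearestDist y i) / dist (y i) (y k)) • (y k - y i) := ⟨_, rfl⟩
  obtain ⟨h1a, h1b⟩ := segment_point hd (by positivity) (by linarith) hp₁
  -- hop 1: `i → p₁`
  obtain ⟨j₁, hj₁, hlo₁, hhi₁, -⟩ := hop (R := 12) hy hν hP hA hf hinj hfr p₁ (lo := 1) (hi := 1) (e := 22 / 5) (L := 31) one_pos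
    (by rw [one_mul]) (by rw [one_mul]) (by norm_num) (by rw [h1a]; linarith) (by rw [dist_comm, h1a]; linarith) (by norm_num)
  -- hop 2: `j₁ → p₂`
  obtain ⟨p₂, hp₂⟩ : ∃ p, p = y i + ((8 * nearestDist y i) / dist (y i) (y k)) • (y k - y i) := ⟨_, rfl⟩
  obtain ⟨h2a, h2b⟩ := segment_point hd (by positivity) (by linarith) hp₂
  have h12 : dist p₁ p₂ = 13 / 5 * nearestDist y i := by
    rw [dist_segment_points hd hp₁ hp₂, show 27 / 5 * nearestDist y i - 8 * nearestDist y i = -(13 / 5 * nearestDist y i) by ring, abs_neg,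
      abs_of_nonneg (by positivity)]
  have hb2 : dist (y j₁) p₂ ≤ nearestDist y j₁ + 13 / 5 * nearestDist y i := by
    have := dist_triangle (y j₁) p₁ p₂
    linarith [hj₁.le]
  have hc2 := mul_le_mul_of_nonneg_right (show ((10011 / 10000 : ℝ)) ^ 31 * 1 + 13 / 5 + 8 ≤ 12 by norm_num) hν.le
  obtain ⟨j₂, hj₂, hlo₂, hhi₂, -⟩ := hop (R := 12) hy hν hP hA hf hinj hfr p₂ (e := 13 / 5) (L := 22) (by positivity) hlo₁ hhi₁ (by norm_num) hb2
    (by rw [dist_comm p₂, h2a]; linarith) (by norm_num)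
  -- last hop: `j₂ → y k`
  have hbk : dist (y j₂) (y k) ≤ nearestDist y j₂ + 7 / 5 * nearestDist y i := by
    have := dist_triangle (y j₂) p₂ (y k)
    linarith [hj₂.le]
  have hc := mul_le_mul_of_nonneg_right (show (10011 / 10000 : ℝ) ^ 22 * ((10011 / 10000 : ℝ) ^ 31 * 1) + 7 / 5 + 47 / 5 ≤ (12 : ℝ) by norm_num) hν.le
  obtain ⟨hlok, hhik⟩ := hop_site (R := 12) hy hν hP hA hf hinj hfr k (e := 7 / 5) (L := 15) (by positivity) hlo₂ hhi₂ (by norm_num) hbk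
    (by linarith) (by norm_num)
  constructor
  · have e1 : (79 / 100 : ℝ) ≤ (9967 / 10000 : ℝ) ^ 15 * ((9967 / 10000 : ℝ) ^ 22 * ((9967 / 10000 : ℝ) ^ 31 * 1)) := by norm_num
    exact le_trans (mul_le_mul_of_nonneg_right e1 hν.le) hlok
  · have e2 : (10011 / 10000 : ℝ) ^ 15 * ((10011 / 10000 : ℝ) ^ 22 * ((10011 / 10000 : ℝ) ^ 31 * 1)) ≤ (27 / 25 : ℝ) := by norm_num
    exact hhik.trans (mul_le_mul_of_nonneg_right e2 hν.le)

/-- **TIER D**: `dist (y k) (y i) ∈ [47/5, 101/10]·nn_i` ⟹ `nn_k ∈ [77/100, 109/100]·nn_i` (hops through `p(27/5), p(8), p(47/5)`, `L = 31, 22, 15, 10`). [this file] -/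
theorem tierD_window {y : Fin N → EuclideanSpace ℝ (Fin 3)} (hy : Function.Injective y) {i : Fin N} (hν : 0 < nearestDist y i)
    (hreg : AffDeepReg 12 (1 / 10 ^ 4) (1 / 1000) (1 / 450) y i) :
    ∀ k, 47 / 5 * nearestDist y i ≤ dist (y k) (y i) → dist (y k) (y i) ≤ 101 / 10 * nearestDist y i →
      77 / 100 * nearestDist y i ≤ nearestDist y k ∧ nearestDist y k ≤ 109 / 100 * nearestDist y i := by
  obtain ⟨A, Q, P, f, hP, hA, hf, hinj, -, -, -⟩ := charts_of_affDeepReg hreg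
  have hfr : ∀ j, dist (y j) (y i) ≤ 12 * nearestDist y i → AffFramed (1 / 10 ^ 4) (1 / 1000) (1 / 450) y j :=
    fun j hj => (hreg j hj).2
  intro k hlow hupp
  have hlow' : 47 / 5 * nearestDist y i ≤ dist (y i) (y k) := by rw [dist_comm]; exact hlow
  have hupp' : dist (y i) (y k) ≤ 101 / 10 * nearestDist y i := by rw [dist_comm]; exact hupp
  have hd : 0 < dist (y i) (y k) := by linarith
  obtain ⟨p₁, hp₁⟩ : ∃ p, p = y i + ((27 / 5 * nearestDist y i) / dist (y i) (y k)) • (y k - y i) := ⟨_, rfl⟩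
  obtain ⟨h1a, h1b⟩ := segment_point hd (by positivity) (by linarith) hp₁
  -- hop 1: `i → p₁`
  obtain ⟨j₁, hj₁, hlo₁, hhi₁, -⟩ := hop (R := 12) hy hν hP hA hf hinj hfr p₁ (lo := 1) (hi := 1) (e := 22 / 5) (L := 31) one_pos
    (by rw [one_mul]) (by rw [one_mul]) (by norm_num) (by rw [h1a]; linarith) (by rw [dist_comm, h1a]; linarith) (by norm_num)
  -- hop 2: `j₁ → p₂`
  obtain ⟨p₂, hp₂⟩ : ∃ p, p = y i + ((8 * nearestDist y i) / dist (y i) (y k)) • (y k - y i) := ⟨_, rfl⟩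
  obtain ⟨h2a, h2b⟩ := segment_point hd (by positivity) (by linarith) hp₂
  have h12 : dist p₁ p₂ = 13 / 5 * nearestDist y i := by
    rw [dist_segment_points hd hp₁ hp₂, show 27 / 5 * nearestDist y i - 8 * nearestDist y i = -(13 / 5 * nearestDist y i) by ring, abs_neg,
      abs_of_nonneg (by positivity)]
  have hb2 : dist (y j₁) p₂ ≤ nearestDist y j₁ + 13 / 5 * nearestDist y i := by
    have := dist_triangle (y j₁) p₁ p₂
    linarith [hj₁.le]
  have hc2 := mul_le_mul_of_nonneg_right (show ((10011 / 10000 : ℝ)) ^ 31 * 1 + 13 / 5 + 8 ≤ 12 by norm_num) hν.le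
  obtain ⟨j₂, hj₂, hlo₂, hhi₂, -⟩ := hop (R := 12) hy hν hP hA hf hinj hfr p₂ (e := 13 / 5) (L := 22) (by positivity) hlo₁ hhi₁ (by norm_num) hb2
    (by rw [dist_comm p₂, h2a]; linarith) (by norm_num)
  -- hop 3: `j₂ → p₃`
  obtain ⟨p₃, hp₃⟩ : ∃ p, p = y i + ((47 / 5 * nearestDist y i) / dist (y i) (y k)) • (y k - y i) := ⟨_, rfl⟩
  obtain ⟨h3a, h3b⟩ := segment_point hd (by positivity) (by linarith) hp₃
  have h23 : dist p₂ p₃ = 7 / 5 * nearestDist y i := by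
    rw [dist_segment_points hd hp₂ hp₃, show 8 * nearestDist y i - 47 / 5 * nearestDist y i = -(7 / 5 * nearestDist y i) by ring, abs_neg,
      abs_of_nonneg (by positivity)]
  have hb3 : dist (y j₂) p₃ ≤ nearestDist y j₂ + 7 / 5 * nearestDist y i := by
    have := dist_triangle (y j₂) p₂ p₃
    linarith [hj₂.le]
  have hc3 := mul_le_mul_of_nonneg_right
    (show ((10011 / 10000 : ℝ)) ^ 22 * ((10011 / 10000) ^ 31 * 1) + 7 / 5 + 47 / 5 ≤ 12 by norm_num) hν.le
  obtain ⟨j₃, hj₃, hlo₃, hhi₃, -⟩ := hop (R := 12) hy hν hP hA hf hinj hfr p₃ (e := 7 / 5) (L := 15) (by positivity) hlo₂ hhi₂ (by norm_num) hb3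
    (by rw [dist_comm p₃, h3a]; linarith) (by norm_num)
  -- last hop: `j₃ → y k`
  have hbk : dist (y j₃) (y k) ≤ nearestDist y j₃ + 7 / 10 * nearestDist y i := by
    have := dist_triangle (y j₃) p₃ (y k)
    linarith [hj₃.le]
  have hc := mul_le_mul_of_nonneg_right (show (10011 / 10000 : ℝ) ^ 15 * ((10011 / 10000 : ℝ) ^ 22 * ((10011 / 10000 : ℝ) ^ 31 * 1)) + 7 / 10 + 101 / 10 ≤ (12 : ℝ) by norm_num) hν.le
  obtain ⟨hlok, hhik⟩ := hop_site (R := 12) hy hν hP hA hf hinj hfr k (e := 7 / 10) (L := 10) (by positivity) hlo₃ hhi₃ (by norm_num) hbk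
    (by linarith) (by norm_num)
  constructor
  · have e1 : (77 / 100 : ℝ) ≤ (9967 / 10000 : ℝ) ^ 10 * ((9967 / 10000 : ℝ) ^ 15 * ((9967 / 10000 : ℝ) ^ 22 * ((9967 / 10000 : ℝ) ^ 31 * 1))) := by norm_num
    exact le_trans (mul_le_mul_of_nonneg_right e1 hν.le) hlok
  · have e2 : (10011 / 10000 : ℝ) ^ 10 * ((10011 / 10000 : ℝ) ^ 15 * ((10011 / 10000 : ℝ) ^ 22 * ((10011 / 10000 : ℝ) ^ 31 * 1))) ≤ (109 / 100 : ℝ) := by norm_num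
    exact hhik.trans (mul_le_mul_of_nonneg_right e2 hν.le)

/-- **TIER E**: `dist (y k) (y i) ∈ [101/10, 21/2]·nn_i` ⟹ `nn_k ∈ [3/4, 11/10]·nn_i` (hops through `p(27/5), p(8), p(47/5), p(101/10)`, `L = 31, 22, 15, 10, 8`).
[this file] -/
theorem tierE_window {y : Fin N → EuclideanSpace ℝ (Fin 3)} (hy : Function.Injective y) {i : Fin N} (hν : 0 < nearestDist y i)
    (hreg : AffDeepReg 12 (1 / 10 ^ 4) (1 / 1000) (1 / 450) y i) :
    ∀ k, 101 / 10 * nearestDist y i ≤ dist (y k) (y i) → dist (y k) (y i) ≤ 21 / 2 * nearestDist y i →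
      3 / 4 * nearestDist y i ≤ nearestDist y k ∧ nearestDist y k ≤ 11 / 10 * nearestDist y i := by
  obtain ⟨A, Q, P, f, hP, hA, hf, hinj, -, -, -⟩ := charts_of_affDeepReg hreg
  have hfr : ∀ j, dist (y j) (y i) ≤ 12 * nearestDist y i → AffFramed (1 / 10 ^ 4) (1 / 1000) (1 / 450) y j :=
    fun j hj => (hreg j hj).2
  intro k hlow hupp
  have hlow' : 101 / 10 * nearestDist y i ≤ dist (y i) (y k) := by rw [dist_comm]; exact hlow
  have hupp' : dist (y i) (y k) ≤ 21 / 2 * nearestDist y i := by rw [dist_comm]; exact hupp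
  have hd : 0 < dist (y i) (y k) := by linarith
  obtain ⟨p₁, hp₁⟩ : ∃ p, p = y i + ((27 / 5 * nearestDist y i) / dist (y i) (y k)) • (y k - y i) := ⟨_, rfl⟩
  obtain ⟨h1a, h1b⟩ := segment_point hd (by positivity) (by linarith) hp₁
  -- hop 1: `i → p₁`
  obtain ⟨j₁, hj₁, hlo₁, hhi₁, -⟩ := hop (R := 12) hy hν hP hA hf hinj hfr p₁ (lo := 1) (hi := 1) (e := 22 / 5) (L := 31) one_pos
    (by rw [one_mul]) (by rw [one_mul]) (by norm_num) (by rw [h1a]; linarith) (by rw [dist_comm, h1a]; linarith) (by norm_num)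
  -- hop 2: `j₁ → p₂`
  obtain ⟨p₂, hp₂⟩ : ∃ p, p = y i + ((8 * nearestDist y i) / dist (y i) (y k)) • (y k - y i) := ⟨_, rfl⟩
  obtain ⟨h2a, h2b⟩ := segment_point hd (by positivity) (by linarith) hp₂
  have h12 : dist p₁ p₂ = 13 / 5 * nearestDist y i := by
    rw [dist_segment_points hd hp₁ hp₂, show 27 / 5 * nearestDist y i - 8 * nearestDist y i = -(13 / 5 * nearestDist y i) by ring, abs_neg,
      abs_of_nonneg (by positivity)]
  have hb2 : dist (y j₁) p₂ ≤ nearestDist y j₁ + 13 / 5 * nearestDist y i := by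
    have := dist_triangle (y j₁) p₁ p₂
    linarith [hj₁.le]
  have hc2 := mul_le_mul_of_nonneg_right (show ((10011 / 10000 : ℝ)) ^ 31 * 1 + 13 / 5 + 8 ≤ 12 by norm_num) hν.le
  obtain ⟨j₂, hj₂, hlo₂, hhi₂, -⟩ := hop (R := 12) hy hν hP hA hf hinj hfr p₂ (e := 13 / 5) (L := 22) (by positivity) hlo₁ hhi₁ (by norm_num) hb2
    (by rw [dist_comm p₂, h2a]; linarith) (by norm_num)
  -- hop 3: `j₂ → p₃`
  obtain ⟨p₃, hp₃⟩ : ∃ p, p = y i + ((47 / 5 * nearestDist y i) / dist (y i) (y k)) • (y k - y i) := ⟨_, rfl⟩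
  obtain ⟨h3a, h3b⟩ := segment_point hd (by positivity) (by linarith) hp₃
  have h23 : dist p₂ p₃ = 7 / 5 * nearestDist y i := by
    rw [dist_segment_points hd hp₂ hp₃, show 8 * nearestDist y i - 47 / 5 * nearestDist y i = -(7 / 5 * nearestDist y i) by ring, abs_neg,
      abs_of_nonneg (by positivity)]
  have hb3 : dist (y j₂) p₃ ≤ nearestDist y j₂ + 7 / 5 * nearestDist y i := by
    have := dist_triangle (y j₂) p₂ p₃
    linarith [hj₂.le]
  have hc3 := mul_le_mul_of_nonneg_right
    (show ((10011 / 10000 : ℝ)) ^ 22 * ((10011 / 10000) ^ 31 * 1) + 7 / 5 + 47 / 5 ≤ 12 by norm_num) hν.le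
  obtain ⟨j₃, hj₃, hlo₃, hhi₃, -⟩ := hop (R := 12) hy hν hP hA hf hinj hfr p₃ (e := 7 / 5) (L := 15) (by positivity) hlo₂ hhi₂ (by norm_num) hb3
    (by rw [dist_comm p₃, h3a]; linarith) (by norm_num)
  -- hop 4: `j₃ → p₄`
  obtain ⟨p₄, hp₄⟩ : ∃ p, p = y i + ((101 / 10 * nearestDist y i) / dist (y i) (y k)) • (y k - y i) := ⟨_, rfl⟩
  obtain ⟨h4a, h4b⟩ := segment_point hd (by positivity) (by linarith) hp₄
  have h34 : dist p₃ p₄ = 7 / 10 * nearestDist y i := by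
    rw [dist_segment_points hd hp₃ hp₄, show 47 / 5 * nearestDist y i - 101 / 10 * nearestDist y i = -(7 / 10 * nearestDist y i) by ring,
      abs_neg, abs_of_nonneg (by positivity)]
  have hb4 : dist (y j₃) p₄ ≤ nearestDist y j₃ + 7 / 10 * nearestDist y i := by
    have := dist_triangle (y j₃) p₃ p₄
    linarith [hj₃.le]
  have hc4 := mul_le_mul_of_nonneg_right
    (show ((10011 / 10000 : ℝ)) ^ 15 * ((10011 / 10000) ^ 22 * ((10011 / 10000) ^ 31 * 1)) + 7 / 10 + 101 / 10 ≤ 12 by norm_num) hν.le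
  obtain ⟨j₄, hj₄, hlo₄, hhi₄, -⟩ := hop (R := 12) hy hν hP hA hf hinj hfr p₄ (e := 7 / 10) (L := 10) (by positivity) hlo₃ hhi₃ (by norm_num) hb4
    (by rw [dist_comm p₄, h4a]; linarith) (by norm_num)
  -- last hop: `j₄ → y k`
  have hbk : dist (y j₄) (y k) ≤ nearestDist y j₄ + 2 / 5 * nearestDist y i := by
    have := dist_triangle (y j₄) p₄ (y k)
    linarith [hj₄.le]
  have hc := mul_le_mul_of_nonneg_right (show (10011 / 10000 : ℝ) ^ 10 * ((10011 / 10000 : ℝ) ^ 15 * ((10011 / 10000 : ℝ) ^ 22 * ((10011 / 10000 : ℝ) ^ 31 * 1))) + 2 / 5 + 21 / 2 ≤ (12 : ℝ) by norm_num) hν.le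
  obtain ⟨hlok, hhik⟩ := hop_site (R := 12) hy hν hP hA hf hinj hfr k (e := 2 / 5) (L := 8) (by positivity) hlo₄ hhi₄ (by norm_num) hbk
    (by linarith) (by norm_num)
  constructor
  · have e1 : (3 / 4 : ℝ) ≤ (9967 / 10000 : ℝ) ^ 8 * ((9967 / 10000 : ℝ) ^ 10 * ((9967 / 10000 : ℝ) ^ 15 * ((9967 / 10000 : ℝ) ^ 22 * ((9967 / 10000 : ℝ) ^ 31 * 1)))) := by norm_num
    exact le_trans (mul_le_mul_of_nonneg_right e1 hν.le) hlok
  · have e2 : (10011 / 10000 : ℝ) ^ 8 * ((10011 / 10000 : ℝ) ^ 10 * ((10011 / 10000 : ℝ) ^ 15 * ((10011 / 10000 : ℝ) ^ 22 * ((10011 / 10000 : ℝ) ^ 31 * 1)))) ≤ (11 / 10 : ℝ) := by norm_num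
    exact hhik.trans (mul_le_mul_of_nonneg_right e2 hν.le)

/-- ★★ **FAR SCALE WINDOW** (summary of «Core» and tiers B–E): under the leaf's hypothesis every site within `(21/2)·nn_i` of `y i` has
`(3/4)·nn_i ≤ nn_k ≤ (11/10)·nn_i`. [this file] -/
theorem far_scale_window {y : Fin N → EuclideanSpace ℝ (Fin 3)} (hy : Function.Injective y) {i : Fin N} (hν : 0 < nearestDist y i)
    (hreg : AffDeepReg 12 (1 / 10 ^ 4) (1 / 1000) (1 / 450) y i) :
    ∀ k, dist (y k) (y i) ≤ 21 / 2 * nearestDist y i → 3 / 4 * nearestDist y i ≤ nearestDist y k ∧ nearestDist y k ≤ 11 / 10 * nearestDist y i := by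
  intro k hk
  rcases le_or_gt (dist (y k) (y i)) (219 / 40 * nearestDist y i) with h | h
  · obtain ⟨h1, h2⟩ := core_scale_window hy hν hreg k h
    exact ⟨by linarith, by linarith⟩
  rcases le_or_gt (dist (y k) (y i)) (8 * nearestDist y i) with h' | h'
  · obtain ⟨h1, h2⟩ := tierB_window hy hν hreg k (by linarith) h'
    exact ⟨by linarith, by linarith⟩
  rcases le_or_gt (dist (y k) (y i)) (47 / 5 * nearestDist y i) with h'' | h''
  · obtain ⟨h1, h2⟩ := tierC_window hy hν hreg k h'.le h''
    exact ⟨by linarith, by linarith⟩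
  rcases le_or_gt (dist (y k) (y i)) (101 / 10 * nearestDist y i) with h''' | h'''
  · obtain ⟨h1, h2⟩ := tierD_window hy hν hreg k h''.le h'''
    exact ⟨by linarith, by linarith⟩
  · exact tierE_window hy hν hreg k h'''.le hk

end Summit.AtomisticToContinuum.Crystallization.Theorems.OverbindingBudgetAffineCompressedCutFar
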